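import Literature.IUT.LogThetaLattice.GlobalLGPFrobenioidsRealifiedRatFn
import HarnessLib

/-!
# [IUTchIII] Proposition 3.7 (ii) «(†𝓕⊛ℝ_𝔪𝔬𝔡)_α» at the model, B: the category `FrakRlfCat F` = the model
# Frobenioid of `(Φ^rlf, ℝ·Φ^birat)` ([FrdI] Prop. 5.3), its isomorphism classes `≅ ℝ`, the realification functor

abc-iut cell, layer L6, wave-5 seat abc-iut-w5-d153; part B of the repair R2 of the audit findings F-w5d153-1 ≡
F-w5d161-1 on `GlobalLGPFrobenioidsRealification.lean` (abc-iut-w4-d005) — see part A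
(`GlobalLGPFrobenioidsRealifiedRatFn.lean`) for the sources, the model of record and the rational function
monoid `ℝ · Φ^birat` (`Prop37.realRatFn`, with its Dirichlet characterisation `mem_realRatFn_iff_frakDeg_eq_zero`).

PRINT. [IUTchIII] Prop. 3.7 (ii) p. 110 l. 48–49 "Write `(†𝓕⊛ℝ_𝔪𝔬𝔡)_α` for the realification of `(†𝓕⊛_𝔪𝔬𝔡)_α`"
[claim key Mochizuki2012, status disputed (D-0012)]; Rmk. 3.6.2 (i) p. 109 "the isomorphism classes … are
determined by the divisor and rational function monoids of the [model] Frobenioid in question [cf. [FrdI],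
Theorem 5.2, (i), (ii)]"; [FrdI] Prop. 5.3 p. 103 (realification = model Frobenioid of `(Φ^rlf, ℝ·Φ^birat)`),
Thm. 5.2 (i) p. 100 (objects `(A_𝒟, α ∈ Φ^gp)`, morphisms `(deg_Fr, Base, Div(φ) ∈ Φ, u_φ ∈ 𝔹)` with
`deg_Fr(φ)·α + Div(φ) = β + u_φ`, composite `(d_ψ d_φ, …, Div ψ + d_ψ·Div φ, u_ψ + d_ψ·u_φ)`)
[cite: MochizukiFrdI2008, Prop. 5.3 p.103] [cite: MochizukiFrdI2008, Thm. 5.2 p.100].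

CONTENTS: `FrakRlfCat F` (objects `ModelFrakObj F = (Φ^rlf)^gp`, morphisms `(n : ℕ+, u ∈ ℝ·Φ^birat)` with
effective zero divisor `u + n•α − β`, composition `(m, u′) ∘ (n, u) = (m n, u′ + m•u)`); the classification
**`nonempty_iso_iff_frakDeg_eq : Nonempty (X ≅ Y) ↔ frakDeg X.obj = frakDeg Y.obj`** + `frakDeg_obj_surjective`
(isomorphism classes `≅ ℝ` via the arithmetic degree); the quotient functor `toRlf` from abc-iut-w4-d005's
`F^×`-enlargement `FrakCat F (ModelPlaces F) (fun _ => ℝ) nonnegModel betaModel` (`(n, f) ↦ (n, Div f)`), THE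
realification functor `realification F := Prop37.realify F ⋙ toRlf F : (†𝓕⊛_𝔪𝔬𝔡)_α ⥤ (†𝓕⊛ℝ_𝔪𝔬𝔡)_α` (object map =
abc-iut-w4-d005's `realifyObj`), and `toRlf_map_negOne` / `not_faithful_toRlf` (the realification forgets the
torsion `μ(F) ⊆ F^×`: `(1, −1) ↦ 𝟙`). Compare part A's `exists_frakDeg_eq_not_iso_enlargement`: in the
`F^×`-enlargement equal degree does NOT imply isomorphic.

NOT done here (junction, named): identification with layer L1's abstract `PreFrobenioid.realification`
(`RealificationData.realSpan`, `RlfModelOf`) over the one-morphism base; the `†ρ_{lgp,v}`-compatibility of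
Prop. 3.7 (v). No `Prop`-valued definition; nothing here asserts a disputed claim or takes a side on [IUTchIII]
Cor. 3.12; typed ≠ discharged; instantiated ≠ endorsed.
-/

noncomputable section

namespace Literature.IUT.LogThetaLattice

namespace Prop37

open CategoryTheory NumberField IsDedekindDomain GlobalFrobenioidModels Literature.IUT.LogVolume

variable (F : Type) [Field F] [NumberField F]


/-! ### `(†𝓕⊛ℝ_𝔪𝔬𝔡)_α`: the model Frobenioid of `(Φ^rlf, ℝ · Φ^birat)` ([FrdI] Thm. 5.2 (i) / Prop. 5.3) -/

/-- **`(†𝓕⊛ℝ_𝔪𝔬𝔡)_α`, the realification of `(†𝓕⊛_𝔪𝔬𝔡)_α`** ([IUTchIII] Prop. 3.7 (ii) p. 110 l. 48–49; [FrdI]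
Prop. 5.3: the model Frobenioid of the divisor monoid `Φ^rlf = ⊕'_v ℝ_{≥0}` and the rational function monoid
`ℝ · Φ^birat`, over the one-morphism base): the type of objects `(∗, α)`, `α ∈ (Φ^rlf)^gp = ModelFrakObj F`.
[claim: Mochizuki2012, status: disputed] -/
def FrakRlfCat : Type := ModelFrakObj F

namespace FrakRlfCat

variable {F}

/-- The object of `(†𝓕⊛ℝ_𝔪𝔬𝔡)_α` with underlying real family `𝔍`. [claim: Mochizuki2012, status: disputed] -/
def of (J : ModelFrakObj F) : FrakRlfCat F := J

/-- The underlying real family of an object of `(†𝓕⊛ℝ_𝔪𝔬𝔡)_α`. [claim: Mochizuki2012, status: disputed] -/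
def obj (X : FrakRlfCat F) : ModelFrakObj F := X

/-- `(of 𝔍).obj = 𝔍`. [claim: Mochizuki2012, status: disputed] -/
@[simp] theorem obj_of (J : ModelFrakObj F) : (of J : FrakRlfCat F).obj = J := rfl

/-- `of X.obj = X`. [claim: Mochizuki2012, status: disputed] -/
@[simp] theorem of_obj (X : FrakRlfCat F) : of X.obj = X := rfl

/-- **A morphism of `(†𝓕⊛ℝ_𝔪𝔬𝔡)_α`** ([FrdI] Thm. 5.2 (i) over the one-morphism base, written additively): a
Frobenius degree `n ∈ ℕ_{≥1}`, a rational function `u ∈ ℝ · Φ^birat`, subject to the zero divisor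
`Div(φ) := u + n•α − β` lying in `Φ^rlf` (being effective) — the relation `n·α + Div(φ) = β + u_φ` of loc. cit.
solved for `Div(φ)`. [cite: MochizukiFrdI2008, Thm. 5.2 p.100] -/
@[ext] structure Hom (X Y : FrakRlfCat F) : Type where
  /-- the Frobenius degree `deg_Fr(φ) ∈ ℕ_{≥1}` -/
  deg : ℕ+
  /-- the rational function `u_φ ∈ ℝ · Φ^birat` -/
  fn : ModelFrakObj F
  /-- `u_φ ∈ ℝ · Φ^birat` -/
  fn_mem : fn ∈ realRatFn F
  /-- the zero divisor `u_φ + deg_Fr(φ)•α − β` is effective (`∈ Φ^rlf`) -/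
  eff : fn + (deg : ℕ) • X.obj - Y.obj ∈ effDiv (ModelPlaces F) (fun _ => ℝ) nonnegModel

/-- The zero divisor of a composite: `(u' + m•Y − Z) + m•(u + n•X − Y) = (u' + m•u) + (m n)•X − Z`.
[cite: MochizukiFrdI2008, Thm. 5.2 p.100] -/
theorem comp_eff_identity (X Y Z u u' : ModelFrakObj F) (n m : ℕ) :
    (u' + m • Y - Z) + m • (u + n • X - Y) = (u' + m • u) + (m * n) • X - Z := by
  rw [mul_nsmul', nsmul_sub, nsmul_add]
  abel

/-- **`(†𝓕⊛ℝ_𝔪𝔬𝔡)_α` is a category**: identity `(1, 0)`, composite `(m, u') ∘ (n, u) = (m n, u' + m•u)` ([FrdI]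
Thm. 5.2 (i): `ψ ∘ φ = (deg_Fr(ψ)·deg_Fr(φ), …, Div(ψ) + deg_Fr(ψ)·Div(φ), u_ψ + deg_Fr(ψ)·u_φ)`).
[cite: MochizukiFrdI2008, Thm. 5.2 p.100] -/
instance : Category (FrakRlfCat F) where
  Hom X Y := Hom X Y
  id X := ⟨1, 0, (realRatFn F).zero_mem, by
    rw [PNat.one_coe, one_nsmul, zero_add, sub_self]
    exact (effDiv (ModelPlaces F) (fun _ => ℝ) nonnegModel).zero_mem⟩
  comp φ ψ := ⟨ψ.deg * φ.deg, ψ.fn + (ψ.deg : ℕ) • φ.fn,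
    (realRatFn F).add_mem ψ.fn_mem ((realRatFn F).nsmul_mem φ.fn_mem _), by
      rw [PNat.mul_coe, ← comp_eff_identity]
      exact (effDiv (ModelPlaces F) (fun _ => ℝ) nonnegModel).add_mem ψ.eff
        ((effDiv (ModelPlaces F) (fun _ => ℝ) nonnegModel).nsmul_mem φ.eff _)⟩
  id_comp φ := by
    apply Hom.ext
    · exact mul_one _
    · show φ.fn + (φ.deg : ℕ) • (0 : ModelFrakObj F) = φ.fn
      rw [nsmul_zero, add_zero]
  comp_id φ := by
    apply Hom.ext
    · exact one_mul _
    · show (0 : ModelFrakObj F) + ((1 : ℕ+) : ℕ) • φ.fn = φ.fn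
      rw [PNat.one_coe, one_nsmul, zero_add]
  assoc φ ψ χ := by
    apply Hom.ext
    · exact (mul_assoc _ _ _).symm
    · show χ.fn + (χ.deg : ℕ) • (ψ.fn + (ψ.deg : ℕ) • φ.fn) =
        χ.fn + (χ.deg : ℕ) • ψ.fn + ((χ.deg * ψ.deg : ℕ+) : ℕ) • φ.fn
      rw [nsmul_add, PNat.mul_coe, mul_nsmul', add_assoc]

/-- The Frobenius degree of a morphism. [cite: MochizukiFrdI2008, Thm. 5.2 p.100] -/
abbrev deg {X Y : FrakRlfCat F} (φ : X ⟶ Y) : ℕ+ := Hom.deg φ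

/-- The rational function `u_φ ∈ ℝ · Φ^birat` of a morphism. [cite: MochizukiFrdI2008, Thm. 5.2 p.100] -/
abbrev fn {X Y : FrakRlfCat F} (φ : X ⟶ Y) : ModelFrakObj F := Hom.fn φ

/-- Extensionality: a morphism is the pair `(deg_Fr, u)`. [cite: MochizukiFrdI2008, Thm. 5.2 p.100] -/
theorem hom_ext {X Y : FrakRlfCat F} {φ ψ : X ⟶ Y} (h₁ : deg φ = deg ψ) (h₂ : fn φ = fn ψ) : φ = ψ :=
  Hom.ext h₁ h₂

/-- The identity is `(1, 0)`. [cite: MochizukiFrdI2008, Thm. 5.2 p.100] -/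
@[simp] theorem deg_id (X : FrakRlfCat F) : deg (𝟙 X) = 1 := rfl

/-- The identity is `(1, 0)`. [cite: MochizukiFrdI2008, Thm. 5.2 p.100] -/
@[simp] theorem fn_id (X : FrakRlfCat F) : fn (𝟙 X) = 0 := rfl

/-- Frobenius degrees multiply. [cite: MochizukiFrdI2008, Thm. 5.2 p.100] -/
@[simp] theorem deg_comp {X Y Z : FrakRlfCat F} (φ : X ⟶ Y) (ψ : Y ⟶ Z) : deg (φ ≫ ψ) = deg ψ * deg φ := rfl

/-- Rational functions compose as `u_ψ + deg_Fr(ψ)•u_φ`. [cite: MochizukiFrdI2008, Thm. 5.2 p.100] -/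
@[simp] theorem fn_comp {X Y Z : FrakRlfCat F} (φ : X ⟶ Y) (ψ : Y ⟶ Z) :
    fn (φ ≫ ψ) = fn ψ + (deg ψ : ℕ) • fn φ := rfl

/-- The rational function of a morphism lies in `ℝ · Φ^birat`. [cite: MochizukiFrdI2008, Thm. 5.2 p.100] -/
theorem fn_mem {X Y : FrakRlfCat F} (φ : X ⟶ Y) : fn φ ∈ realRatFn F := Hom.fn_mem φ

/-- The zero divisor of a morphism is effective. [cite: MochizukiFrdI2008, Thm. 5.2 p.100] -/
theorem eff_mem {X Y : FrakRlfCat F} (φ : X ⟶ Y) :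
    fn φ + (deg φ : ℕ) • X.obj - Y.obj ∈ effDiv (ModelPlaces F) (fun _ => ℝ) nonnegModel :=
  Hom.eff φ

/-- Constructor for morphisms. [cite: MochizukiFrdI2008, Thm. 5.2 p.100] -/
def homMk {X Y : FrakRlfCat F} (n : ℕ+) (u : ModelFrakObj F) (hu : u ∈ realRatFn F)
    (h : u + (n : ℕ) • X.obj - Y.obj ∈ effDiv (ModelPlaces F) (fun _ => ℝ) nonnegModel) : X ⟶ Y :=
  ⟨n, u, hu, h⟩

/-- `deg (homMk n u _ _) = n`. [cite: MochizukiFrdI2008, Thm. 5.2 p.100] -/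
@[simp] theorem deg_homMk {X Y : FrakRlfCat F} (n : ℕ+) (u : ModelFrakObj F) (hu : u ∈ realRatFn F)
    (h : u + (n : ℕ) • X.obj - Y.obj ∈ effDiv (ModelPlaces F) (fun _ => ℝ) nonnegModel) :
    deg (homMk n u hu h) = n := rfl

/-- `fn (homMk n u _ _) = u`. [cite: MochizukiFrdI2008, Thm. 5.2 p.100] -/
@[simp] theorem fn_homMk {X Y : FrakRlfCat F} (n : ℕ+) (u : ModelFrakObj F) (hu : u ∈ realRatFn F)
    (h : u + (n : ℕ) • X.obj - Y.obj ∈ effDiv (ModelPlaces F) (fun _ => ℝ) nonnegModel) :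
    fn (homMk n u hu h) = u := rfl

/-! ### Isomorphism classes of `(†𝓕⊛ℝ_𝔪𝔬𝔡)_α` are classified by the arithmetic degree -/

/-- The linear morphism `(1, β − α) : α → β` between two objects of the SAME arithmetic degree (its rational
function `β − α` has degree `0`, hence lies in `ℝ · Φ^birat` by Dirichlet; zero divisor `0`).
[cite: MochizukiFrdI2008, Prop. 5.3 p.103] -/
def linearHomOfFrakDegEq {X Y : FrakRlfCat F} (h : frakDeg X.obj = frakDeg Y.obj) : X ⟶ Y :=
  homMk 1 (Y.obj - X.obj) ((mem_realRatFn_iff_frakDeg_eq_zero F _).mpr (by rw [frakDeg_sub, h, sub_self]))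
    (by
      rw [PNat.one_coe, one_nsmul, sub_add_cancel, sub_self]
      exact (effDiv (ModelPlaces F) (fun _ => ℝ) nonnegModel).zero_mem)

/-- **Objects of equal degree are isomorphic in `(†𝓕⊛ℝ_𝔪𝔬𝔡)_α`.** [cite: MochizukiFrdI2008, Prop. 5.3 p.103] -/
def isoOfFrakDegEq {X Y : FrakRlfCat F} (h : frakDeg X.obj = frakDeg Y.obj) : X ≅ Y where
  hom := linearHomOfFrakDegEq h
  inv := linearHomOfFrakDegEq h.symm
  hom_inv_id := hom_ext rfl (by
    show (X.obj - Y.obj) + ((1 : ℕ+) : ℕ) • (Y.obj - X.obj) = 0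
    rw [PNat.one_coe, one_nsmul, sub_add_sub_cancel, sub_self])
  inv_hom_id := hom_ext rfl (by
    show (Y.obj - X.obj) + ((1 : ℕ+) : ℕ) • (X.obj - Y.obj) = 0
    rw [PNat.one_coe, one_nsmul, sub_add_sub_cancel, sub_self])

/-- An isomorphism has Frobenius degree `1`. [cite: MochizukiFrdI2008, Thm. 5.2 p.100] -/
theorem deg_hom_eq_one_of_iso {X Y : FrakRlfCat F} (e : X ≅ Y) : deg e.hom = 1 := by
  have h := congrArg (fun k : ℕ+ => (k : ℕ)) (congrArg deg e.hom_inv_id)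
  simp only [deg_comp, deg_id, PNat.mul_coe, PNat.one_coe] at h
  exact PNat.coe_eq_one_iff.mp (Nat.eq_one_of_mul_eq_one_left h)

/-- An isomorphism has Frobenius degree `1` (inverse). [cite: MochizukiFrdI2008, Thm. 5.2 p.100] -/
theorem deg_inv_eq_one_of_iso {X Y : FrakRlfCat F} (e : X ≅ Y) : deg e.inv = 1 :=
  deg_hom_eq_one_of_iso e.symm

/-- **Isomorphic objects of `(†𝓕⊛ℝ_𝔪𝔬𝔡)_α` have the same arithmetic degree**: for an isomorphism `(1, u)` with
inverse `(1, −u)` both zero divisors `±(u + α − β)` are effective, so (sharpness of `ℝ_{≥0}`) `β − α = u ∈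
ℝ · Φ^birat` has degree `0`. [cite: MochizukiFrdI2008, Prop. 5.3 p.103] -/
theorem frakDeg_eq_of_iso {X Y : FrakRlfCat F} (e : X ≅ Y) : frakDeg X.obj = frakDeg Y.obj := by
  have h1 := deg_hom_eq_one_of_iso e
  have h2 := deg_inv_eq_one_of_iso e
  have hfn : fn e.inv + fn e.hom = 0 := by
    have h := congrArg fn e.hom_inv_id
    rwa [fn_comp, fn_id, h2, PNat.one_coe, one_nsmul] at h
  have heH := eff_mem e.hom
  have heI := eff_mem e.inv
  rw [h1, PNat.one_coe, one_nsmul] at heH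
  rw [h2, PNat.one_coe, one_nsmul] at heI
  -- `heI`'s divisor is minus `heH`'s
  have hneg : fn e.inv + Y.obj - X.obj = -(fn e.hom + X.obj - Y.obj) := by
    have : fn e.inv = -fn e.hom := eq_neg_of_add_eq_zero_left hfn
    rw [this]
    abel
  rw [hneg] at heI
  have hzero : fn e.hom + X.obj - Y.obj = 0 := by
    refine FrakObj.ext_cls (funext fun v => ?_)
    exact (modelHyps_places F).sharp v _ (mem_effDiv.mp heH v)
      (by simpa only [FrakObj.cls_neg] using mem_effDiv.mp heI v)
  have hu : Y.obj - X.obj = fn e.hom := by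
    rw [eq_comm, ← sub_eq_zero]
    rw [← hzero]
    abel
  have hdeg := (mem_realRatFn_iff_frakDeg_eq_zero F _).mp (fn_mem e.hom)
  rw [← hu, frakDeg_sub] at hdeg
  linarith

/-- **The isomorphism classes of `(†𝓕⊛ℝ_𝔪𝔬𝔡)_α` are classified by the arithmetic degree** ([IUTchIII] Rmk. 3.6.2
(i): "the isomorphism classes … are determined by the divisor and rational function monoids"; [FrdI] Thm. 6.4
(i): `δ_A : Pic_Φ(A) ⥲ ℝ`). [cite: MochizukiFrdI2008, Thm. 6.4 (i) p.114] -/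
theorem nonempty_iso_iff_frakDeg_eq (X Y : FrakRlfCat F) : Nonempty (X ≅ Y) ↔ frakDeg X.obj = frakDeg Y.obj :=
  ⟨fun ⟨e⟩ => frakDeg_eq_of_iso e, fun h => ⟨isoOfFrakDegEq h⟩⟩

/-- Every real number is the degree of an object of `(†𝓕⊛ℝ_𝔪𝔬𝔡)_α` (campaign S `degF_surjective` through the
dictionary) — so the isomorphism classes are in bijection with `ℝ`. [cite: MochizukiFrdI2008, Thm. 6.4 (i) p.114] -/
theorem frakDeg_obj_surjective : Function.Surjective fun X : FrakRlfCat F => frakDeg X.obj := by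
  intro r
  obtain ⟨a, ha⟩ := degF_surjective F r
  refine ⟨of (frakObjEquivADivisor.symm a), ?_⟩
  show degF F (frakDivisor ((frakObjEquivADivisor (F := F)).symm a)) = r
  rw [← frakObjEquivADivisor_apply, Equiv.apply_symm_apply, ha]

end FrakRlfCat

/-! ### The realification functor and the quotient from the `F^×`-enlargement -/

/-- **The quotient functor from the `F^×`-ENLARGEMENT onto the realification**: identity on objects,
`(n, f) ↦ (n, Div(f))` — abc-iut-w4-d005's codomain `FrakCat F (ModelPlaces F) (fun _ => ℝ) nonnegModel betaModel`
(objects of the realification, rational functions still `f ∈ F^×_mod`) maps onto `(†𝓕⊛ℝ_𝔪𝔬𝔡)_α` by forgetting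
`f` down to its divisor. [cite: MochizukiFrdI2008, Prop. 5.3 p.103] -/
def toRlf : FrakCat F (ModelPlaces F) (fun _ => ℝ) nonnegModel betaModel ⥤ FrakRlfCat F where
  obj X := FrakRlfCat.of X.obj
  map {X Y} φ := FrakRlfCat.homMk (FrakCat.deg φ) (prinFamily F (FrakCat.fn φ)) (prinFamily_mem_realRatFn F _)
    ((prinFamily_add_nsmul_sub_mem_effDiv_iff F X.obj Y.obj _ _).mpr (FrakCat.Hom.isHom φ))
  map_id X := FrakRlfCat.hom_ext rfl (by
    show prinFamily F (FrakCat.fn (𝟙 X)) = 0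
    rw [FrakCat.fn_id, prinFamily_one])
  map_comp {X Y Z} φ ψ := FrakRlfCat.hom_ext rfl (by
    show prinFamily F (FrakCat.fn (φ ≫ ψ)) =
      prinFamily F (FrakCat.fn ψ) + (FrakCat.deg ψ : ℕ) • prinFamily F (FrakCat.fn φ)
    rw [FrakCat.fn_comp, prinFamily_mul, prinFamily_pow])

/-- `toRlf` is the identity on objects. [cite: MochizukiFrdI2008, Prop. 5.3 p.103] -/
@[simp] theorem toRlf_obj_obj (X : FrakCat F (ModelPlaces F) (fun _ => ℝ) nonnegModel betaModel) :
    ((toRlf F).obj X).obj = X.obj := rfl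

/-- `toRlf` preserves Frobenius degrees. [cite: MochizukiFrdI2008, Prop. 5.3 p.103] -/
@[simp] theorem deg_toRlf_map {X Y : FrakCat F (ModelPlaces F) (fun _ => ℝ) nonnegModel betaModel} (φ : X ⟶ Y) :
    FrakRlfCat.deg ((toRlf F).map φ) = FrakCat.deg φ := rfl

/-- `toRlf` sends `f` to `Div(f)`. [cite: MochizukiFrdI2008, Prop. 5.3 p.103] -/
@[simp] theorem fn_toRlf_map {X Y : FrakCat F (ModelPlaces F) (fun _ => ℝ) nonnegModel betaModel} (φ : X ⟶ Y) :
    FrakRlfCat.fn ((toRlf F).map φ) = prinFamily F (FrakCat.fn φ) := rfl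

/-- **THE realification functor `(†𝓕⊛_𝔪𝔬𝔡)_α → (†𝓕⊛ℝ_𝔪𝔬𝔡)_α`** ([IUTchIII] Prop. 3.7 (v) p. 112 l. 2–4 "the products
of realification functors … [cf. [FrdI], Proposition 5.3]"): abc-iut-w4-d005's `Prop37.realify` (objects:
`realifyObj`, integral classes `ℤ ↪ ℝ`) followed by the quotient `toRlf` (rational functions `f ↦ Div(f)`).
[claim: Mochizuki2012, status: disputed] -/
def realification : Ffrak F ⥤ FrakRlfCat F := realify F ⋙ toRlf F

/-- The object map of the realification functor IS abc-iut-w4-d005's `realifyObj`.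
[claim: Mochizuki2012, status: disputed] -/
@[simp] theorem realification_obj_obj (X : Ffrak F) : ((realification F).obj X).obj = realifyObj F X.obj := rfl

/-- The realification functor on morphisms: `(n, f) ↦ (n, Div(f))`. [claim: Mochizuki2012, status: disputed] -/
theorem fn_realification_map {X Y : Ffrak F} (φ : X ⟶ Y) :
    FrakRlfCat.fn ((realification F).map φ) = prinFamily F (FrakCat.fn φ) := rfl

/-- **The realification forgets the torsion of `F^×`**: the endomorphism `(1, −1) ≠ 𝟙` of the enlargement goes
to `𝟙` — so `toRlf` (and `realification`) is NOT faithful, in accordance with [IUTchIII] Rmk. 3.6.2 (i)(a) (the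
rational function monoid of the realification is `ℝ · Φ^birat`, not `F^×_mod`). [cite: MochizukiFrdI2008, Prop. 5.3 p.103] -/
theorem toRlf_map_negOne (X : FrakCat F (ModelPlaces F) (fun _ => ℝ) nonnegModel betaModel) :
    (toRlf F).map (FrakCat.homMk 1 (-1) (isHom_negOne F X)) = 𝟙 ((toRlf F).obj X) :=
  FrakRlfCat.hom_ext rfl (by
    show prinFamily F (FrakCat.fn (FrakCat.homMk 1 (-1) (isHom_negOne F X))) = 0
    rw [FrakCat.fn_homMk, prinFamily_neg_one])

/-- **`toRlf` is not faithful.** [cite: MochizukiFrdI2008, Prop. 5.3 p.103] -/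
theorem not_faithful_toRlf : ¬ (toRlf F).Faithful := by
  intro hF
  exact homMk_negOne_ne_id F (FrakCat.of 0)
    (hF.map_injective (by rw [toRlf_map_negOne, CategoryTheory.Functor.map_id]))

end Prop37

end Literature.IUT.LogThetaLattice

end
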